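import Mathlib
import HarnessLib
import Literature.MathematicalPhysics.StatisticalMechanics.PolymerFactorisationDifference

/-!
# Mixed second differences of finite products:
# `∏(K+U+V) − ∏(K+U) − ∏(K+V) + ∏K = Σ_{∅≠T} ∏_T V · (∏_{Tᶜ}(K+U) − ∏_{Tᶜ}K)` and the norm bound
# `≤ [∏(c+u+v) − ∏(c+u)] − [∏(c+v) − ∏c]` ([ABKM19] Ch. 9: second derivatives of the polynomial maps)

Continuation of `PolymerFactorisationDifference.lean` (`tayNormLE_prod_sub_prod`: first differences of
finite products of local functionals, the derivative-free form of the `D P` bounds of [ABKM19] Lemmas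
9.4–9.6).  The smoothness half of Theorem 2.2 consumes SECOND derivatives of the polynomial maps
(products of block/site functionals) — in the tree, parallelogram second differences.  For factors
`K_i`, `K_i + U_i`, `K_i + V_i`, `K_i + U_i + V_i` (a parallelogram in each factor) the mixed second
difference of the products is, by the binomial expansion in the `V`-slots,
`Σ_{∅ ≠ T ⊆ S} (∏_{i∈T} V_i)·(∏_{i∈S∖T}(K_i+U_i) − ∏_{i∈S∖T} K_i)`, a sum of (product of increments) ×
(first difference of a shorter product); hence

* **`tayNormLE_prod_secondDiff`** — if `|K_i| ≤ c_i`, `|U_i| ≤ u_i`, `|V_i| ≤ v_i` in `T_i`-local weighted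
  Taylor norms (`T_i ≤ T`, `∏ w_i ≤ w`), then
  `|∏(K+U+V) − ∏(K+U) − ∏(K+V) + ∏K|_{T,w} ≤ [∏(c+u+v) − ∏(c+u)] − [∏(c+v) − ∏c]`
  (the same second difference of the numerical products; `≤ |S|(|S|−1)·u·v·(c+u+v)^{|S|−2}` for constant
  bounds).

Everything is proved; no named fact.

## References
* S. Adams, S. Buchholz, R. Kotecký, S. Müller, arXiv:1910.13564, Lemma 9.4 (9.20), Lemmas 9.5–9.6
  (bounds on the derivatives of `P₁`, `P₂`, `P₃`) [AdamsBuchholzKoteckyMuller2019].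
-/

noncomputable section

namespace Literature.MathematicalPhysics.StatisticalMechanics.GradientRG

open scoped BigOperators Classical
open Finset
open Literature.MathematicalPhysics.QuantumFieldTheory

variable {d M : ℕ} [NeZero M]
  {V : Type*} [NormedAddCommGroup V] [NormedSpace ℝ V]

/-- The binomial identity behind the second difference: for commuting quantities,
`∏(g+v) − ∏g = Σ_{∅≠T⊆S} ∏_T v ∏_{S∖T} g`. [cite: AdamsBuchholzKoteckyMuller2019, Lemma 9.4 (9.20)] -/
theorem prod_add_sub_prod_eq_sum {R : Type*} [CommRing R] {ι : Type*} (S : Finset ι) (v g : ι → R) :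
    ∏ i ∈ S, (g i + v i) - ∏ i ∈ S, g i
      = ∑ T ∈ S.powerset.erase ∅, (∏ i ∈ T, v i) * ∏ i ∈ S \ T, g i := by
  have h := Finset.prod_add (fun i => v i) (fun i => g i) S
  rw [← Finset.add_sum_erase _ _ (Finset.empty_mem_powerset S)] at h
  simp only [Finset.prod_empty, Finset.sdiff_empty, one_mul] at h
  have h' : ∏ i ∈ S, (g i + v i) = ∏ i ∈ S, (v i + g i) := Finset.prod_congr rfl fun i _ => add_comm _ _
  rw [h', h]
  ring

/-- **Mixed second differences of finite products of local functionals.**  For `T_i`-local `C^{r₀}`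
functionals `K_i, U_i, V_i` with `|K_i|_{T_i,w_i} ≤ c_i`, `|U_i|_{T_i,w_i} ≤ u_i`, `|V_i|_{T_i,w_i} ≤ v_i`
(`c, u, v ≥ 0`), gauges `T_i ≤ T` and `∏_i w_i ≤ w`:
`|∏(K_i+U_i+V_i) − ∏(K_i+U_i) − ∏(K_i+V_i) + ∏K_i|_{T,w} ≤ (∏(c+u+v) − ∏(c+u)) − (∏(c+v) − ∏c)`.
[cite: AdamsBuchholzKoteckyMuller2019, Lemma 9.5 (9.26)] -/
theorem tayNormLE_prod_secondDiff {ι : Type*} {T : ((Fin d → ZMod M) → ℝ) →ₗ[ℝ] V} {r₀ : ℕ}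
    {w : ((Fin d → ZMod M) → ℝ) → ℝ}
    {Vi : ι → Type*} [∀ i, NormedAddCommGroup (Vi i)] [∀ i, NormedSpace ℝ (Vi i)]
    {Ti : ∀ i, ((Fin d → ZMod M) → ℝ) →ₗ[ℝ] Vi i} {wi : ι → ((Fin d → ZMod M) → ℝ) → ℝ}
    {Ki Ui Wi : ι → ((Fin d → ZMod M) → ℝ) → ℂ} {c u v : ι → ℝ} (S : Finset ι)
    (hK : ∀ i ∈ S, TayNormLE (Ti i) r₀ (wi i) (Ki i) (c i))
    (hU : ∀ i ∈ S, TayNormLE (Ti i) r₀ (wi i) (Ui i) (u i))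
    (hW : ∀ i ∈ S, TayNormLE (Ti i) r₀ (wi i) (Wi i) (v i))
    (hle : ∀ i ∈ S, ∀ ξ, ‖Ti i ξ‖ ≤ ‖T ξ‖)
    (hKd : ∀ i ∈ S, ContDiff ℝ r₀ (Ki i)) (hUd : ∀ i ∈ S, ContDiff ℝ r₀ (Ui i)) (hWd : ∀ i ∈ S, ContDiff ℝ r₀ (Wi i))
    (hKloc : ∀ i ∈ S, IsGaugeLocal (Ti i) (Ki i)) (hUloc : ∀ i ∈ S, IsGaugeLocal (Ti i) (Ui i))
    (hWloc : ∀ i ∈ S, IsGaugeLocal (Ti i) (Wi i))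
    (hc : ∀ i ∈ S, 0 ≤ c i) (hu : ∀ i ∈ S, 0 ≤ u i) (hv : ∀ i ∈ S, 0 ≤ v i)
    (hw : ∀ φ, ∏ i ∈ S, wi i φ ≤ w φ) :
    TayNormLE T r₀ w
      (fun φ => ∏ i ∈ S, (Ki i φ + Ui i φ + Wi i φ) - ∏ i ∈ S, (Ki i φ + Ui i φ)
        - ∏ i ∈ S, (Ki i φ + Wi i φ) + ∏ i ∈ S, Ki i φ)
      (((∏ i ∈ S, (c i + u i + v i)) - ∏ i ∈ S, (c i + u i)) - ((∏ i ∈ S, (c i + v i)) - ∏ i ∈ S, c i)) := by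
  -- the expansion in the `V`-slots
  have hfun : (fun φ => ∏ i ∈ S, (Ki i φ + Ui i φ + Wi i φ) - ∏ i ∈ S, (Ki i φ + Ui i φ)
        - ∏ i ∈ S, (Ki i φ + Wi i φ) + ∏ i ∈ S, Ki i φ) = fun φ =>
      ∑ 𝒯 ∈ S.powerset.erase ∅, (∏ i ∈ 𝒯, Wi i φ) *
        (∏ i ∈ S \ 𝒯, (Ki i φ + Ui i φ) - ∏ i ∈ S \ 𝒯, Ki i φ) := by
    funext φ
    have h1 := prod_add_sub_prod_eq_sum S (fun i => Wi i φ) (fun i => Ki i φ + Ui i φ)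
    have h2 := prod_add_sub_prod_eq_sum S (fun i => Wi i φ) (fun i => Ki i φ)
    have e : ∏ i ∈ S, (Ki i φ + Ui i φ + Wi i φ) - ∏ i ∈ S, (Ki i φ + Ui i φ)
        - ∏ i ∈ S, (Ki i φ + Wi i φ) + ∏ i ∈ S, Ki i φ
        = (∏ i ∈ S, (Ki i φ + Ui i φ + Wi i φ) - ∏ i ∈ S, (Ki i φ + Ui i φ))
          - (∏ i ∈ S, (Ki i φ + Wi i φ) - ∏ i ∈ S, Ki i φ) := by ring
    rw [e, h1, h2, ← Finset.sum_sub_distrib]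
    refine Finset.sum_congr rfl fun 𝒯 _ => ?_
    ring
  have hconst : ((∏ i ∈ S, (c i + u i + v i)) - ∏ i ∈ S, (c i + u i)) - ((∏ i ∈ S, (c i + v i)) - ∏ i ∈ S, c i)
      = ∑ 𝒯 ∈ S.powerset.erase ∅, (∏ i ∈ 𝒯, v i) *
          ((∏ i ∈ S \ 𝒯, (c i + u i)) - ∏ i ∈ S \ 𝒯, c i) := by
    rw [prod_add_sub_prod_eq_sum S v (fun i => c i + u i), prod_add_sub_prod_eq_sum S v c,
      ← Finset.sum_sub_distrib]
    refine Finset.sum_congr rfl fun 𝒯 _ => ?_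
    ring
  rw [hfun, hconst]
  have hKUd : ∀ i ∈ S, ContDiff ℝ r₀ (fun φ => Ki i φ + Ui i φ) := fun i hi => (hKd i hi).add (hUd i hi)
  have hKUloc : ∀ i ∈ S, IsGaugeLocal (Ti i) (fun φ => Ki i φ + Ui i φ) := fun i hi φ ψ h => by
    show Ki i φ + Ui i φ = Ki i ψ + Ui i ψ
    rw [hKloc i hi φ ψ h, hUloc i hi φ ψ h]
  refine TayNormLE.sum (T := T) (r₀ := r₀) (S.powerset.erase ∅) (fun 𝒯 h𝒯 => ?_) (fun 𝒯 h𝒯 => ?_)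
  · have h𝒯S : 𝒯 ⊆ S := Finset.mem_powerset.1 (Finset.mem_of_mem_erase h𝒯)
    have hdS : S \ 𝒯 ⊆ S := sdiff_subset
    -- the increments on `𝒯`
    have h1 := TayNormLE.prod (T := T) (r₀ := r₀) (w := fun φ => ∏ i ∈ 𝒯, wi i φ) (Ti := fun i => Ti i)
      (wi := fun i => wi i) (Ki := fun i => Wi i) (Ci := v) 𝒯
      (fun i hi => hW i (h𝒯S hi)) (fun i hi => hle i (h𝒯S hi)) (fun i hi => hWd i (h𝒯S hi))
      (fun i hi => hWloc i (h𝒯S hi)) (fun i hi => hv i (h𝒯S hi)) (fun φ => le_rfl)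
    -- the first difference of the shorter product (`tayNormLE_prod_sub_prod` with `K' = K`, `K = K + U`)
    have hΔ : ∀ i ∈ S \ 𝒯, TayNormLE (Ti i) r₀ (wi i) (fun φ => (Ki i φ + Ui i φ) - Ki i φ) (u i) := by
      intro i hi
      have e : (fun φ => (Ki i φ + Ui i φ) - Ki i φ) = Ui i := by funext φ; ring
      rw [e]; exact hU i (hdS hi)
    have h2 := tayNormLE_prod_sub_prod (T := T) (Ti := fun i => Ti i) (wi := fun i => wi i)
      (Ki := fun i => fun φ => Ki i φ + Ui i φ) (Ki' := fun i => Ki i) (c := c) (ρ := u)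
      (w := fun φ => ∏ i ∈ S \ 𝒯, wi i φ) (S \ 𝒯)
      (fun i hi => hK i (hdS hi)) hΔ (fun i hi => hle i (hdS hi)) (fun i hi => hKUd i (hdS hi))
      (fun i hi => hKd i (hdS hi)) (fun i hi => hKUloc i (hdS hi)) (fun i hi => hKloc i (hdS hi))
      (fun i hi => hc i (hdS hi)) (fun i hi => hu i (hdS hi)) (fun φ => le_rfl)
    have hC2 : 0 ≤ (∏ i ∈ S \ 𝒯, (c i + u i)) - ∏ i ∈ S \ 𝒯, c i :=
      sub_nonneg.2 (Finset.prod_le_prod (fun i hi => hc i (hdS hi))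
        fun i hi => le_add_of_nonneg_right (hu i (hdS hi)))
    refine TayNormLE.mul (T := T) (w := w) h1 h2 (fun ξ => le_rfl) (fun ξ => le_rfl)
      (contDiff_prod fun i hi => hWd i (h𝒯S hi))
      ((contDiff_prod fun i hi => hKUd i (hdS hi)).sub (contDiff_prod fun i hi => hKd i (hdS hi)))
      (IsGaugeLocal.prod _ fun i hi => (hWloc i (h𝒯S hi)).of_norm_le (hle i (h𝒯S hi)))
      (IsGaugeLocal.op₂ _ (fun a b : ℂ => a - b)
        (IsGaugeLocal.prod _ fun i hi => (hKUloc i (hdS hi)).of_norm_le (hle i (hdS hi)))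
        (IsGaugeLocal.prod _ fun i hi => (hKloc i (hdS hi)).of_norm_le (hle i (hdS hi))))
      (Finset.prod_nonneg fun i hi => hv i (h𝒯S hi)) hC2 (fun φ => ?_)
    rw [← Finset.prod_union (disjoint_sdiff), Finset.union_sdiff_of_subset h𝒯S]
    exact hw φ
  · have h𝒯S : 𝒯 ⊆ S := Finset.mem_powerset.1 (Finset.mem_of_mem_erase h𝒯)
    exact (contDiff_prod fun i hi => hWd i (h𝒯S hi)).mul
      ((contDiff_prod fun i hi => (hKd i (sdiff_subset hi)).add (hUd i (sdiff_subset hi))).sub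
        (contDiff_prod fun i hi => hKd i (sdiff_subset hi)))

end Literature.MathematicalPhysics.StatisticalMechanics.GradientRG

end
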